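import Mathlib
import HarnessLib
import HarnessLib.Audit
import Summits.AtomisticToContinuum.Statement

/-!
Route: PhononLenardBalescu

CLOSED (retired) 2026-08-15T13:45:24Z by operator:999:1257524 — reason: not-a-thesis: assembly does not conclude the sub-problem Statement — note: D-0027 §2.1 audit (human 2026-08-15: routes that do not decide the summit are removed): the assembly concludes `KineticWindowConductivity`, not the sub-problem statement; a NEW conforming route may be opened from the same idea (generated `closes : … → _root_.FouriersLaw`).. The file is kept as the record of this route; refuted decls are indexed as negative knowledge (`ledger negatives`).

# Route PhononLenardBalescu — Phonon Lenard–Balescu rung — Green–Kubo law in the 1/n kinetic window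
of the O(n) vector extension of pinnedChain (analogue rung, declared)

ANALOGUE RUNG (declared; precedent route-AnomalousDissipation-SabraStatics): X is a theorem about
the O(n) VECTOR EXTENSION of the
conjunct's chain — q_x, p_x ∈ ℝⁿ on the isolated M-site chain, H_n = Σ_x [|p_x|²/2 + ω₂|q_x|²/2 +
(lam/4n)|q_x|⁴] + Σ_bonds [|r|²/2 + (β/4n)|r|⁴],
total energy current J = Σ_bonds −½(1 + (β/n)|r_x|²)(p_x + p_{x+1})·r_x, Hamiltonian flow, Gibbs
data at temperature T — whose n = 1 member is
pinnedChain ω₂ lam β γ VERBATIM (support AtOneIsPinnedChain). X does NOT imply FouriersLaw: frame #1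
(X → conjunct) is not claimed, no n-uniform
statement down to n = 1 is filed, and the Assembly closes X, not the conjunct. It suffices to show X
(KINETIC-WINDOW GREEN–KUBO LAW, realises
card large-n-phonon-lenard-balescu): for all ω₂, lam, β > 0 and every T > 0 there is κ̄(T) ∈ (0, ∞)
such that the equilibrium Einstein–Helfand
conductivity per component, 𝒦_{n,M}(t) := E_{Gibbs(T)}[(∫_0^t J ds)²] / (2 t M n T²), evaluated in
the kinetic window t = nτ, obeys
lim_{τ→∞} lim_{n→∞} lim_{M→∞} 𝒦_{n,M}(nτ)/n = κ̄(T) (limits in the ∀ε–eventually sense, M → ∞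
first). X = X2 ∘ X4 where X2 = KineticWindowLaplace
(the window limit exists and is the Fejér–Laplace transform of a finite positive spectral measure
ν_T — the abstract form of ⟨v, e^{−τL}v⟩ with
L ≥ 0 the NLO kinetic operator) and X4 = WindowSpectralPositivity (ν_T has no zero mode, is
non-zero, and ∫ s⁻¹ dν_T < ∞, i.e. κ̄ = ⟨v, L⁻¹v⟩ ∈ (0,∞)).
Around X the route files the accessible rung OnsetOfDamping (golden-rule decay at times n^r s, 1/2 <
r < 1: resistance appears at first order in
1/n), the informal crux LenardBalescuIdentification (L is the SCREENED phonon Lenard–Balescu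
operator of the Hartree band, not the bare
Peierls–Boltzmann operator; filed after open pending a definition request) and supports making the
leading order explicit: at n = ∞ the chain is
the Hartree HARMONIC chain — the catalogued barrier HarmonicChainBallisticFlux derived as a limit
(HartreeBallisticLeadingOrder) — with
stiffnesses (Ω_T, K_T) solving the gap equations and growing like √T (HartreeGapEquation: the small
parameter 1/n is uniform in T), and the extra
O(n) Noether charges are Mazur-silent for heat (NoetherMazurSilence).
Lean: `∀ (ω₂ lam β : ℝ), 0 < ω₂ → 0 < lam → 0 < β → ∀ (T : ℝ), 0 < T → let H : (n M : ℕ) → (Fin M →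
Fin n → ℝ) × (Fin M → Fin n → ℝ) → ℝ := fun n M z => (∑ x : Fin M, ((∑ a, (z.2 x a) ^ 2) / 2 + ω₂ *
(∑ a, (z.1 x a) ^ 2) / 2 + lam / (4 * (n : ℝ)) * (∑ a, (z.1 x a) ^ 2) ^ 2)) + ∑ x : Fin M, ∑ y : Fin
M, (if y.val = x.val + 1 then ((∑ a, (z.1 y a - z.1 x a) ^ 2) / 2 + β / (4 * (n : ℝ)) * (∑ a, (z.1 y
a - z.1 x a) ^ 2) ^ 2) else 0); let J : (n M : ℕ) → (Fin M → Fin n → ℝ) × (Fin M → Fin n → ℝ) → ℝ :=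
fun n M z => ∑ x : Fin M, ∑ y : Fin M, (if y.val = x.val + 1 then -((1 + β / (n : ℝ) * ∑ a, (z.1 y a
- z.1 x a) ^ 2) * (∑ a, (z.2 x a + z.2 y a) * (z.1 y a - z.1 x a))) / 2 else 0); let F : (n M : ℕ) →
(Fin M → Fin n → ℝ) × (Fin M → Fin n → ℝ) → Fin M → Fin n → ℝ := fun n M z x a => -(ω₂ + lam / (n :
ℝ) * ∑ b, (z.1 x b) ^ 2) * z.1 x a + (∑ y : Fin M, (if y.val = x.val + 1 then (1 + β / (n : ℝ) * ∑
b, (z.1 y b - z.1 x b) ^ 2) * (z.1 y a - z.1 x a) else 0)) - ∑ y : Fin M, (if x.val = y.val + 1 then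
(1 + β / (n : ℝ) * ∑ b, (z.1 x b - z.1 y b) ^ 2) * (z.1 x a - z.1 y a) else 0); let IsFlow : (n M :
ℕ) → (ℝ → (Fin M → Fin n → ℝ) × (Fin M → Fin n → ℝ) → (Fin M → Fin n → ℝ) × (Fin M → Fin n → ℝ)) →
Prop := fun n M Φ => Continuous (fun p : ℝ × ((Fin M → Fin n → ℝ) × (Fin M → Fin n → ℝ)) => Φ p.1
p.2) ∧ (∀ z, Φ 0 z = z) ∧ ∀ z (x : Fin M) (t : ℝ), HasDerivAt (fun s => (Φ s z).1 x) ((Φ t z).2 x) t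
∧ HasDerivAt (fun s => (Φ s z).2 x) (F n M (Φ t z) x) t; let μ : (n M : ℕ) → MeasureTheory.Measure
((Fin M → Fin n → ℝ) × (Fin M → Fin n → ℝ)) := fun n M => (∫⁻ z, ENNReal.ofReal (Real.exp (-(H n M
z) / T)))⁻¹ • MeasureTheory.volume.withDensity (fun z => ENNReal.ofReal (Real.exp (-(H n M z) /
T))); let 𝒦 : (n M : ℕ) → (ℝ → (Fin M → Fin n → ℝ) × (Fin M → Fin n → ℝ) → (Fin M → Fin n → ℝ) ×
(Fin M → Fin n → ℝ)) → ℝ → ENNReal := fun n M Φ t => ENNReal.ofReal (1 / (2 * t * (M : ℝ) * (n : ℝ)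
* T ^ 2)) * ∫⁻ z, ENNReal.ofReal ((∫ s in (0 : ℝ)..t, J n M (Φ s z)) ^ 2) ∂(μ n M); ∃ κ : ℝ, 0 < κ ∧
∀ ε : ℝ, 0 < ε → ∃ τ₀ : ℝ, ∀ τ : ℝ, τ₀ ≤ τ → 0 < τ → ∀ᶠ n : ℕ in Filter.atTop, ∀ᶠ M : ℕ in
Filter.atTop, ∀ Φ, IsFlow n M Φ → |(𝒦 n M Φ ((n : ℝ) * τ)).toReal / (n : ℝ) - κ| ≤ ε`

## Assembly
Pure measure theory (no physics): from KineticWindowLaplace take ν = ν_T; WindowSpectralPositivity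
(applied to this ν, whose hypothesis is exactly
the conclusion of KineticWindowLaplace) gives ν{0} = 0, ν ≠ 0, ∫_{(0,∞)} s⁻¹dν < ∞; put κ̄ := ∫ s⁻¹
dν ∈ (0, ∞) (positive since ν ≠ 0 is carried
by (0,∞)). By Tonelli g(τ) := τ⁻¹∫_0^τ(τ−u)∫e^{−us}dν du = ∫ φ_τ(s) dν(s) with φ_τ(s) =
τ⁻¹∫_0^τ(τ−u)e^{−us}du ≤ 1/s and φ_τ(s) → 1/s as τ → ∞
for s > 0, so g(τ) → κ̄ by dominated convergence (dominating function s⁻¹ ∈ L¹(ν), the atom at 0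
excluded). Given ε, choose τ₀ with
|g(τ) − κ̄| ≤ ε/2 for τ ≥ τ₀ and use KineticWindowLaplace at (τ, ε/2); the `∀ᶠ n, ∀ᶠ M, ∀ Φ` filters
pass through the triangle inequality. The
two items share their `let` preambles verbatim, so the hypothesis/conclusion match definitionally
(dsimp only).

Rationale: WHY THIS LINE. Make every site's environment Gaussian by the LAW OF LARGE NUMBERS over internal
components instead of by low temperature: at n = ∞ the O(n)
chain is the self-consistent (Hartree) harmonic chain — ballistic, i.e. exactly
Literature.Barriers.AtomisticToContinuum.HarmonicChainBallisticFlux,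
now DERIVED as the leading order of the conjunct's own one-parameter family — and thermal resistance
is the first 1/n fluctuation correction,
carried on times t ≍ n by a kinetic operator whose vertex is dynamically screened by the
|q|²-density (breathing) modes, the lattice analogue of the
Lenard–Balescu operator (large-N structure: ColemanJackiwPolitzer1974; NLO-as-screened-kinetics:
BergesRothkopfSchmidt2008, AartsResco2004,
AartsBerges2002, MihailaDawsonCooper2001 on this very 1+1-d lattice). Imported area, with the card's
explicit dictionary (N particles with 1/N pair
force ↦ n components with (lam/n) contact quartic; Vlasov field ↦ Hartree stiffness; dielectric
ε(k,k·v) ↦ 1 − lamΠ_T(q,Ω); plasmon ↦ breathing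
mode; Lenard–Balescu at O(1/N) on times O(N) ↦ screened phonon operator at O(1/n) on times O(n)):
the rigorous mean-field FLUCTUATION theory of
plasmas — DuerinckxSaintraymond2021 (LB as the O(1/N) correction, consistency on t ≍ N^r),
Duerinckx2021 (size of chaos), DuerinckxWinter2023
(well-posedness), arXiv:2511.10778 (Duerinckx–Le Bihan 2025: linearised LB thermalisation AT
EQUILIBRIUM on t ≍ N for a truncated hierarchy — the
equilibrium setting is ours: X is an equilibrium time-correlation statement) — joined to lattice
kinetic limits of equilibrium time correlations
(LukkarinenSpohn2010, AokiLukkarinenSpohn2006, LukkarinenSpohn2008, Spohn2006PhononBoltzmann). What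
it does that the four open routes
(FourierGreenKubo, FeketeResistance, LocalOhmRigidity, SuperadditiveJunction — all at n = 1, no
small parameter) and the kinetic-corner cards
(small λ = lamT, βT, dead at high T by the scaling conjugacy LowTemperatureWeakAnharmonicity) do
not: a perturbative handle 1/n that is UNIFORM IN T
(Hartree stiffnesses grow like √T exactly as thermal amplitudes do), typed statements of "Fourier's
law is a 1/n effect", and the identification
of the NLO operator the sibling cards kraichnan-random-coupling-dmft-ladder /
onset-of-resistance-secular-series must use; negatives index empty.

RANKED CRUXES. #0 KineticWindowConductivity (target) — X: for all ω₂, lam, β > 0 and T > 0 there is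
κ̄ > 0 with: ∀ ε > 0 ∃ τ₀ ∀ τ ≥ τ₀ (τ > 0), eventually in n, eventually in M, for every Hamiltonian
flow Φ of the isolated M-site O(n) chain, |𝒦_{n,M}(nτ)/n − κ̄| ≤ ε, where 𝒦_{n,M}(t) =
E_{Gibbs(T)}[(∫_0^t J(Φ_s z) ds)²]/(2tMnT²) is the Einstein–Helfand finite-time conductivity per
component (objects defined inline by `let`: H, J, force F, IsFlow, Gibbs measure μ, 𝒦). (why it
might fail: Inherits KineticWindowLaplace and WindowSpectralPositivity; nothing is claimed at fixed
n (κ_n/n² → κ̄ needs an n-uniform post-window tail, NOT filed) nor at n = 1.)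
[BonettoLebowitzReyBellet2000 §7 (37), Spohn2006PhononBoltzmann, DuerinckxSaintraymond2021, card
large-n-phonon-lenard-balescu]
#2 KineticWindowLaplace (crux) — (card L2, existence half) KINETIC WINDOW: for all ω₂, lam, β > 0, T
> 0 there is a finite positive Borel measure ν_T on [0, ∞) (the spectral measure of the NLO kinetic
generator at the current) such that for every τ > 0: eventually in n, eventually in M, for every
flow Φ, |𝒦_{n,M}(nτ)/n − τ⁻¹ ∫_0^τ (τ − u) (∫ e^{−us} dν_T(s)) du| ≤ ε — i.e. at times t = nτ the
per-component current autocorrelation converges, after the Fejér average built into 𝒦, to the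
Laplace transform c_T(u) = ∫ e^{−us} dν_T(s) = ⟨v, e^{−uL}v⟩ of a positive operator; the oscillatory
Hartree terms average out under the u-integral and need no pointwise limit. [difficulty:
open-problem] (why it might fail: Needs propagation of chaos for the collective fields |q_x|²/n
along the DETERMINISTIC flow with Gibbs data up to kinetic times t≍n; the particle analogue
(Lenard–Balescu on t≍N) is open — DuerinckxSaintraymond2021 reach t≍N^r, r<1/18, arXiv:2511.10778
only a truncated hierarchy.) [DuerinckxSaintraymond2021, arXiv:2511.10778, Duerinckx2021,
LukkarinenSpohn2010, AokiLukkarinenSpohn2006 §3, Spohn2006PhononBoltzmann]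
#4 WindowSpectralPositivity (crux) — (card: LBKernelPositivity, abstract form) for all parameters
and T > 0 and every finite measure ν on [0,∞) whose Fejér–Laplace transform is the kinetic-window
limit of 𝒦_{n,M}(nτ)/n (hypothesis = the conclusion of KineticWindowLaplace for this ν; ν is then
unique): ν{0} = 0 (no zero mode of the NLO operator in the odd/current sector: the collisional
invariants number and energy are even), ν ≠ 0, and ∫_{(0,∞)} s⁻¹ dν(s) < ∞ (the current lies in the
domain of L^{−1/2}: no anomalous tail) — so that κ̄(T) = ∫ s⁻¹ dν = ⟨v, L⁻¹v⟩ ∈ (0, ∞). [deps: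
KineticWindowLaplace] [difficulty: L] (why it might fail: Fails if ν has an atom at 0 (hidden odd
conserved quantity, or an undamped breathing mode: a real zero of 1−lamΠ_T on the two-phonon
continuum) or an anomalous tail ∫s⁻¹dν=∞ as for unpinned FPU (LukkarinenSpohn2008, t^(-3/5));
pinning of the Hartree band is essential.) [LukkarinenSpohn2008 Thm 2.2/Prop 2.4/Thm 2.5, Spohn2006,
AokiLukkarinenSpohn2006 §3 (3.25), HuveneersLukkarinen2020, DuerinckxWinter2023]
#5 OnsetOfDamping (crux) — (accessible rung, golden-rule regime) there is σ_T > 0 (the screened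
golden-rule rate ⟨v, Lv⟩ in the units of 𝒦) such that for every r ∈ (1/2, 1) and s₁, s₂ > 0:
eventually in n, eventually in M, for every flow, n^{1−r} [𝒦_{n,M}(n^r s₁)/(n^r s₁) − 𝒦_{n,M}(n^r
s₂)/(n^r s₂)] → σ_T (s₂ − s₁)/6 — i.e. for n^{1/2} ≪ t ≪ n one has 𝒦_{n,M}(t)/t = D_{T,n}/2 − σ_T
t/(6n) + O(1/t): resistance appears at FIRST order in 1/n with a positive rate; the two-time
difference cancels the finite-n plateau D_{T,n} and the O(1/t) band-edge tails of the Hartree chain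
(hence r > 1/2). [difficulty: L] (why it might fail: The golden-rule regime n^(1/2)≪t≪n must carry
no secular 1/n term other than −σt: a degenerate resonance (van Hove edge of the Hartree band on the
2↔2 manifold) or slowly ringing collective modes could make the 1/n correction superlinear in t; for
r≤1/2 the signal is masked by O(1/t) tails.) [DuerinckxSaintraymond2021, Duerinckx2021,
MihailaDawsonCooper2001, AartsBerges2002, BergesRothkopfSchmidt2008, LukkarinenSpohn2010]
#9 HartreeBallisticLeadingOrder (support) — (card L0: the harmonic barrier as derived leading order)
there is D_T > 0 (the Drude weight of the Hartree harmonic chain with stiffnesses (Ω_T, K_T)) such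
that ∀ ε ∃ t₀ ∀ t ≥ t₀: eventually in n, eventually in M, for every flow, |𝒦_{n,M}(t)/t − D_T/2| ≤ ε
— at FIXED time the n → ∞ limit is the Hartree harmonic chain (law of large numbers over components
/ McKean–Vlasov limit with Gibbs data) and it conducts ballistically (𝒦 grows linearly), i.e.
HarmonicChainBallisticFlux as a limit theorem; provable with known technology (propagation of chaos
on bounded times + Gaussian computation). [difficulty: M] [Sznitman1991, doi:10.1007/BF01611497
(Braun–Hepp 1977), BricmontKupiainen2007 §3 (naive closure = renormalised ω₂, ballistic),
RoyDhar2008, decl Literature.Barriers.AtomisticToContinuum.HarmonicChainBallisticFlux (proved)]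
#9 HartreeGapEquation (support) — (card L1, T-uniformity) for ω₂ > 0, lam, β ≥ 0 and every T > 0 the
Hartree gap equations Ω = ω₂ + lam T/√(Ω(Ω+4K)), K = 1 + (βT/K)(1 − √(Ω/(Ω+4K))) (equilibrium
variances of the harmonic chain with pinning Ω and bond stiffness K: E q² = T/√(Ω(Ω+4K)), E r² =
(T/K)(1 − √(Ω/(Ω+4K)))) have a positive solution, and for lam, β > 0 EVERY positive solution
satisfies c√T ≤ Ω, K ≤ C√T for T ≥ T₀ (scale-free regime: the Hartree frequency grows exactly like
the thermal amplitude, so the relative NLO strength g(T)/n stays bounded along the whole temperature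
ray). Real analysis, provable now; planner numerics: unique solution found, Ω/√T → 0.647, K/√T →
0.763 at ω₂ = lam = β = 1. [difficulty: provable-now] [ColemanJackiwPolitzer1974, decl
Literature.Barriers.AtomisticToContinuum.LowTemperatureWeakAnharmonicity (scaling conjugacy),
AokiLukkarinenSpohn2006 §2 (2.11)-(2.12)]
#9 NoetherMazurSilence (support) — (card L3) for n ≥ 2 and a ≠ b the angular momenta L^{ab} = Σ_x
(q^a_x p^b_x − q^b_x p^a_x) are conserved by every flow of the O(n) chain, J·L^{ab} is
Gibbs-integrable and E_{Gibbs}[J L^{ab}] = 0 (reflection q^a, p^a ↦ −q^a, −p^a preserves H, J and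
the Gibbs measure and flips L^{ab}): the extra extensive charges of the vector chain are
Mazur-silent for the heat current. Provable now (polynomial × Gaussian-dominated integrability;
measure-preserving involution). [difficulty: provable-now] [Mazur1969, decl
Literature.Barriers.AtomisticToContinuum.Mazur1969_inequality, Spohn2006]
#9 AtOneIsPinnedChain (support) — (the family contains the conjunct's chain) at n = 1 the inline
Hamiltonian and total current coincide with the tree's: H_{1,M}(z) = (pinnedChain ω₂ lam β
γ).hamiltonian M (q, p) and J_{1,M}(z) = Σ_i (pinnedChain ω₂ lam β γ).bondCurrent M i (q, p) with
q_i = z.1 i 0, p_i = z.2 i 0 (deriv of V(r) = r²/2 + βr⁴/4 is (1 + βr²)r). Definitional regression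
test, provable now by simp/ring. [difficulty: provable-now] [BonettoLebowitzReyBellet2000 §3 eq. (8)
and §5.2 eq. (23), decl Literature.MathematicalPhysics.KineticTheory.HeatConduction.pinnedChain]
#9 GlobalFlow (support) — (non-vacuity of `∀ Φ, IsFlow n M Φ → …`) for ω₂, lam, β > 0 and all n, M
the Hamiltonian vector field of the O(n) chain (explicit polynomial force F = −∇_q H_n) has a unique
global flow in the class IsFlow (jointly continuous, Φ_0 = id, Hamilton's equations everywhere):
local Picard–Lindelöf + conservation of the coercive energy H_n ≥ Σ|p|²/2 + ω₂Σ|q|²/2. [difficulty: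
M] [LanfordLebowitzLieb1977 (contrast: infinite volume), folklore (Picard–Lindelöf + energy
conservation), Mathlib IsPicardLindelof]

TWO-LAYER PLAN. Foreseen glued splits (nothing filed now; k ≤ 3, depth 1): KineticWindowLaplace ⇐
ShortWindow (the same statement for τ ≤ τ₀(T): equilibrium
cumulant/Duhamel expansion of DuerinckxSaintraymond2021 type transplanted to the lattice,
LukkarinenSpohn2010 technology for the oscillatory phonon
integrals) → WindowExtension (from τ₀ to all τ via a priori L²(Gibbs) bounds on correlations and the
renormalised-propagator idea of
arXiv:2511.10778) → KineticWindowLaplace. WindowSpectralPositivity ⇐ (once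
LenardBalescuIdentification has a signature) OddSectorKernel (collisional
invariants of the screened 2↔2 operator on the pinned Hartree band are span{1, ω̃}, both even ⇒ ν{0}
= 0 for the odd current; Spohn2006,
LukkarinenSpohn2008 Thm 2.2) → OddSectorCoercivity (collision frequency bounded below on the pinned
band and 1 − lamΠ_T ≠ 0 on the resonant set ⇒
∫ s⁻¹dν < ∞) → WindowSpectralPositivity. OnsetOfDamping ⇐ SecondOrderEquilibriumExpansion (the 1/n
term of 𝒦 at times ≪ n as an explicit
oscillatory integral over the Hartree band) → GoldenRuleAsymptotics (its t → ∞ linear growth with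
rate σ_T > 0, stationary phase with pinned
dispersion) → OnsetOfDamping.

KILL CRITERIA. (a) A proof (or decisive numerics: equilibrium MD of O(n) chains, n ∈ {16, 64}, M =
256, all parameters 1, T ∈ {0.2, 1, 5}) that 𝒦_{n,M}(nτ)/n has
no finite positive τ → ∞ limit — anomalous tail or plateau — refutes WindowSpectralPositivity on the
PINNED Hartree band: close
`refuted:WindowSpectralPositivity` (and hand the witness to FourierGreenKubo's crux 0703 as evidence
about pinned kinetic operators). (b) A secular
1/n correction superlinear in t in the golden-rule regime refutes OnsetOfDamping ⇒ the 1/n expansion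
is not kinetic ⇒ close `refuted:OnsetOfDamping`.
(c) If κ̄(T) coincides with the BARE Peierls–Boltzmann value of the Hartree band at high T
(screening not O(1)), the card's headline
(LenardBalescuIdentification) is refuted but X survives: pivot by `--restate` of that item to the
bare operator and regrade the route `variant`.
(d) A zero of 1 − lamΠ_T on the two-phonon continuum at some (ω₂, T) (undamped breathing mode)
forces a two-fluid restatement of X4 (pivot, not
close). Proof of FourierGreenKubo.FourierGreenKubo (0703) at all T does not moot the rung (different
theorem) but drops its staffing priority.

NOT DECOMPOSED YET. The explicit objects of the identification — Hartree band ω̃_T(k)² = Ω_T +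
2K_T(1 − cos k), retarded bubble Π_T(q, Ω), screened kernels
|lam/(1 − lamΠ_T)|² and the β-channel analogue, the operator L_LB(T), the current v = ω̃ω̃′ — are a
DEFINITION REQUEST, after which
LenardBalescuIdentification gets a signature and X4 its split. Deliberately NOT filed (they are a
second thesis, the card's own top rung with the
onset-of-resistance slab engine): the OPEN bathed O(n) chain — HartreeLimit of the NESS at fixed N
with Langevin ends (lim_n D_N^{(n)}/n =
(N−1)c_N of an inhomogeneous Hartree chain) and the crossover (N−1)n²/D_N^{(n)} → ρ_c + x/κ̄(T) at N
≍ n ℓ̄(T). Also not filed: uniformity of all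
limits on compact T-sets (carried informally by HartreeGapEquation), the n-uniform post-window tail
/ interchange giving κ_n/n² → κ̄ at fixed large
n (NOT claimed, the residual shared with every kinetic card), anything at n = 1, and the diffusive
'spin' sector of the Noether charges L^{ab}.

CHEAPEST FALSIFIER. Run first: (i) static screening strength — from HartreeGapEquation, the q = 0, Ω
= 0 dielectric factor is ε_T(0,0) = 1 + lamT(2Ω+4K)/(2(Ω(Ω+4K))^{3/2});
planner evaluation at ω₂ = lam = β = 1: ε → 1 + 0.59 as T → ∞ (vertex suppressed by ε⁻² ≈ 0.40 —
screening IS O(1) in the scale-free regime) and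
ε ≈ 1 + 0.27·lamT as T → 0 (bare Boltzmann recovered), consistent with the card; a refuter should
redo this at finite (q, Ω) on the resonant
manifold and look for zeros of 1 − lamΠ_T (kill criterion (d)). (ii) The card's MD test: κ_n/n² at n
∈ {1, 4, 16, 64}, M = 256, T = 5 against the
bare-Boltzmann value of the Hartree band (kit job not submitted by this planner seat). (iii) Lookup:
any printed kinetic limit for an O(n)/large-N
LATTICE at NLO with transport coefficients (searched: none; AartsResco2004 is continuum QFT shear
viscosity, MihailaDawsonCooper2001/AartsBerges2002 are
thermalisation studies of this lattice without κ).

NUMBERS. Hartree scale-free constants at ω₂ = lam = β = 1 (planner numerics of HartreeGapEquation):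
Ω_T/√T → 0.647, K_T/√T → 0.763, unique positive
solution at every T tested (10⁻² … 10⁶); static dielectric factor ε_∞(0,0) ≈ 1.59. Rigorous
Lenard–Balescu status: consistency on t ≍ N^r, r < 1/18
(DuerinckxSaintraymond2021, as restated in arXiv:2511.10778 §1.2), full t ≍ N only for a truncated
hierarchy in large dimension (arXiv:2511.10778).
What pinning must avoid: unpinned FPU-β kinetic tail C(t) ≍ t^{−3/5}, κ_N ≍ N^{2/5}
(LukkarinenSpohn2008 Thm 2.5, decl LukkarinenSpohn2008_lemma41).
OnsetOfDamping window: r ∈ (1/2, 1) (band-edge tails O(t^{−1/2}) in the correlation, O(1/t) in 𝒦/t).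
Items at open: 10 typed (1 target, 3 cruxes,
5 support, 1 assembly) + 1 informal crux (rank 3) filed right after open = 11 ≤ 15.

DEFINITION REQUESTS. (1) `VectorOscillatorChain` (topic
Literature/MathematicalPhysics/KineticTheory): the O(n) chain API mirroring OscillatorChain — phase
space
(Fin M → Fin n → ℝ)², hamiltonian H_n, total/bond currents, explicit force and IsFlow, Gibbs
measure, Einstein–Helfand conductivity 𝒦_{n,M}(t), and
the Langevin generator with baths on every component of the end sites (for the unfiled open-chain
rung); once landed, a tenure pass restates every
item over the named defs (same meaning; the `let` preambles are verbatim copies of these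
definitions). (2) `PhononLenardBalescuOperator` (topic
Summits/AtomisticToContinuum/FouriersLaw/Theorems or Literature/MathematicalPhysics/KineticTheory):
Hartree band, bubble Π_T, screened 2↔2 kernel on
the resonant manifold of the pinned nearest-neighbour dispersion (ALS06/LS08 parametrisation),
L_LB(T) on weighted L²(𝕋), current v; needed to give
LenardBalescuIdentification (rank 3, informal at open) a signature. No cite-fact is needed as a
hypothesis: every item is hypothesis-free and the
only catalogued fact used for calibration (HarmonicChainBallisticFlux) is proved.

Novelty: Searches (2026-08-15, this seat; local `lit search` daemon down — ConnectionResetError —,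
OpenAlex/arXiv APIs rate-limited, so crossref/zbMATH +
reads): `lit frontier AtomisticToContinuum --since 2020` (30 rows; relevant: arXiv:2605.19308
wave-kinetic derivation for β-FPUT, arXiv:2310.13338;
nothing large-n), `lit bridges AtomisticToContinuum --cross any` (30 rows, none on
internal-dimension limits), `lit search --source crossref
"Lenard-Balescu correction mean-field Duerinckx derivation"` (12: doi:10.2140/pmp.2021.2.27,
doi:10.1007/s00205-023-01901-9,
doi:10.1007/s00220-021-03978-3, doi:10.1016/j.aml.2024.109195), `lit search --source zbmath
"Lenard-Balescu derivation" --year-from 2019` (1: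
arXiv:2511.10778, READ pp. 1–4: "a rigorous justification is still beyond reach … best result … t ≍
N^r"), `lit search --source crossref "thermal
conductivity O(N) model large N expansion 2PI resummation transport coefficients"` (AartsResco
2004/2005/2006 — continuum QFT only), `lit search
--source crossref "classical O(N) scalar field 1+1 dimensions large N thermalization"`
(doi:10.1016/s0550-3213(00)00447-8 Aarts–Bonini–Wetterich
2000), `lit galaxy search "Lenard-Balescu phonon" --star all` (galaxyd saturated, rc 1 — not
charged; to be re-run by the novelty audit),
`ledger negatives --problem AtomisticToContinuum` (0), the sub's 4 route files and 93 cards (none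
with an internal-dimension small parameter except
the two side remarks named by the card), plus the card's own audit (refuter-n  [refs: 10.2140/pmp.2021.2.27, 10.1007/s00205-023-01901-9, 10.1007/s00220-021-03978-3, 10.1016/j.aml.2024.109195, 10.1016/s0550-3213(00, 10.1103/physrevd.10.2491:, 10.1103/physrevlett.101.041603:, 10.1088/1126-6708/2004/02/061:, 2605.19308, 2310.13338, 2511.10778, doi:10.2140/pmp.2021.2.27, doi:10.1007/s00205-023-01901-9, doi:10.1007/s00220-021-03978-3, doi:10.1016/j.aml.2024.109195, doi:10.1016/s0550-321]

Barriers (technique_class: large-n mean-field-fluctuation lenard-balescu kinetic-window): - technique_class: large-n mean-field-fluctuation lenard-balescu kinetic-window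
- Literature.Barriers.AtomisticToContinuum.HarmonicChainBallisticFlux: USED, not fought — it is the
n = ∞ leading order (HartreeBallisticLeadingOrder: 𝒦/t → D_T/2 > 0, ballistic); every dissipative
statement of the route (OnsetOfDamping, X) lives at order 1/n and is singular at n = ∞ exactly as
the barrier audit demands of evaders ("retain the anharmonic collision term").
- Literature.Barriers.AtomisticToContinuum.LowTemperatureWeakAnharmonicity: evaded along the ladder
axis only — the expansion parameter is 1/n, uniform in T by HartreeGapEquation (Ω_T, K_T ≍ √T); at
fixed n = 1 nothing is claimed, and κ̄(T) is expected to match the ALS kinetic corner as lamT → 0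
(screening → 1 + 0.27·lamT).
- Literature.Barriers.AtomisticToContinuum.LukkarinenSpohn2008_lemma41: the FPU anomaly is the
recorded failure mode of WindowSpectralPositivity without pinning; the route keeps ω₂ > 0 so the
Hartree band is pinned (Ω_T ≥ ω₂ > 0, no acoustic branch) and states finiteness of ∫ s⁻¹dν as the
crux, not as an assumption.
- Literature.Barriers.AtomisticToContinuum.Mazur1969_inequality: engaged — the vector chain HAS
extra extensive charges L^{ab}; NoetherMazurSilence proves them orthogonal to the heat current
(reflection symmetry), and any further hidden odd charge is exactly kill criterion (a) (atom of ν_T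
at 0).
- Literature.Barriers.AtomisticToContinuum.MacroErgodicityBarrier: not entered — only scaling-window
st

History (route lifecycle, newest last):
- 2026-08-15T13:45:25Z · CLOSED retired — not-a-thesis: assembly does not conclude the sub-problem Statement (operator:999:1257524)

sub-problem: FouriersLaw · status: closed(retired) · opened planner-plancard-AtomisticToContinuum-Fourier-8d08a7e7-0 2026-08-15T11:40:39Z · rev 0 · ledger route-AtomisticToContinuum-PhononLenardBalescu
GENERATED by the gate from the ledger (D-0016/17). Provers cite these decls: `theorem foo : Summit.AtomisticToContinuum.FouriersLaw.Theses.PhononLenardBalescu.<Decl> := …` in Summits/AtomisticToContinuum/FouriersLaw/Theorems/<Name>.lean.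
-/

namespace Summit.AtomisticToContinuum.FouriersLaw.Theses.PhononLenardBalescu

open scoped BigOperators Topology Manifold Classical MeasureTheory ProbabilityTheory Matrix InnerProductSpace ComplexConjugate ContinuousMap
open Filter Set Function TopologicalSpace MeasureTheory

attribute [summit_statement] _root_.FouriersLaw

/-- item stmt-AtomisticToContinuum-5294 · target · rank 0 · closed · moot by None · by planner
why it might fail: Inherits KineticWindowLaplace and WindowSpectralPositivity; nothing is claimed at fixed n (κ_n/n² → κ̄ needs an n-uniform post-window tail, NOT filed) nor at n = 1.
sources: BonettoLebowitzReyBellet2000 §7 (37), Spohn2006PhononBoltzmann, DuerinckxSaintraymond2021, card large-n-phonon-lenard-balescu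
[target] X: for all ω₂, lam, β > 0 and T > 0 there is κ̄ > 0 with: ∀ ε > 0 ∃ τ₀ ∀ τ ≥ τ₀ (τ > 0),
eventually in n, eventually in M, for every Hamiltonian flow Φ of the isolated M-site O(n) chain,
|𝒦_{n,M}(nτ)/n − κ̄| ≤ ε, where 𝒦_{n,M}(t) = E_{Gibbs(T)}[(∫_0^t J(Φ_s z) ds)²]/(2tMnT²) is the
Einstein–Helfand finite-time conductivity per component (objects defined inline by `let`: H, J,
force F, IsFlow, Gibbs measure μ, 𝒦). -/
@[route_item "route-AtomisticToContinuum-PhononLenardBalescu"]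
def KineticWindowConductivity : Prop :=
  ∀ (ω₂ lam β : ℝ), 0 < ω₂ → 0 < lam → 0 < β → ∀ (T : ℝ), 0 < T → let H : (n M : ℕ) → (Fin M → Fin n → ℝ) × (Fin M → Fin n → ℝ) → ℝ := fun n M z => (∑ x : Fin M, ((∑ a, (z.2 x a) ^ 2) / 2 + ω₂ * (∑ a, (z.1 x a) ^ 2) / 2 + lam / (4 * (n : ℝ)) * (∑ a, (z.1 x a) ^ 2) ^ 2)) + ∑ x : Fin M, ∑ y : Fin M, (if y.val = x.val + 1 then ((∑ a, (z.1 y a - z.1 x a) ^ 2) / 2 + β / (4 * (n : ℝ)) * (∑ a, (z.1 y a - z.1 x a) ^ 2) ^ 2) else 0); let J : (n M : ℕ) → (Fin M → Fin n → ℝ) × (Fin M → Fin n → ℝ) → ℝ := fun n M z => ∑ x : Fin M, ∑ y : Fin M, (if y.val = x.val + 1 then -((1 + β / (n : ℝ) * ∑ a, (z.1 y a - z.1 x a) ^ 2) * (∑ a, (z.2 x a + z.2 y a) * (z.1 y a - z.1 x a))) / 2 else 0); let F : (n M : ℕ) → (Fin M → Fin n → ℝ) × (Fin M → Fin n → ℝ)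 → Fin M → Fin n → ℝ := fun n M z x a => -(ω₂ + lam / (n : ℝ) * ∑ b, (z.1 x b) ^ 2) * z.1 x a + (∑ y : Fin M, (if y.val = x.val + 1 then (1 + β / (n : ℝ) * ∑ b, (z.1 y b - z.1 x b) ^ 2) * (z.1 y a - z.1 x a) else 0)) - ∑ y : Fin M, (if x.val = y.val + 1 then (1 + β / (n : ℝ) * ∑ b, (z.1 x b - z.1 y b) ^ 2) * (z.1 x a - z.1 y a) else 0); let IsFlow : (n M : ℕ) → (ℝ → (Fin M → Fin n → ℝ) × (Fin M → Fin n → ℝ) → (Fin M → Fin n → ℝ) × (Fin M → Fin n → ℝ)) → Prop := fun n M Φ => Continuous (fun p : ℝ × ((Fin M → Fin n → ℝ) × (Fin M → Fin n → ℝ)) => Φ p.1 p.2) ∧ (∀ z, Φ 0 z = z) ∧ ∀ z (x : Fin M) (t : ℝ), HasDerivAt (fun s => (Φ s z).1 x) ((Φ t z).2 x) t ∧ HasDerivAt (fun s => (Φ s z).2 x) (F n M (Φ t z) x) t; let μ : (n M : ℕ) → MeasureTheory.Measure ((Fin M → Fin n → ℝ) × (Fin M → Fin n → ℝ)) := fun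 n M => (∫⁻ z, ENNReal.ofReal (Real.exp (-(H n M z) / T)))⁻¹ • MeasureTheory.volume.withDensity (fun z => ENNReal.ofReal (Real.exp (-(H n M z) / T))); let 𝒦 : (n M : ℕ) → (ℝ → (Fin M → Fin n → ℝ) × (Fin M → Fin n → ℝ) → (Fin M → Fin n → ℝ) × (Fin M → Fin n → ℝ)) → ℝ → ENNReal := fun n M Φ t => ENNReal.ofReal (1 / (2 * t * (M : ℝ) * (n : ℝ) * T ^ 2)) * ∫⁻ z, ENNReal.ofReal ((∫ s in (0 : ℝ)..t, J n M (Φ s z)) ^ 2) ∂(μ n M); ∃ κ : ℝ, 0 < κ ∧ ∀ ε : ℝ, 0 < ε → ∃ τ₀ : ℝ, ∀ τ : ℝ, τ₀ ≤ τ → 0 < τ → ∀ᶠ n : ℕ in Filter.atTop, ∀ᶠ M : ℕ in Filter.atTop, ∀ Φ, IsFlow n M Φ → |(𝒦 n M Φ ((n : ℝ) * τ)).toReal / (n : ℝ) - κ| ≤ ε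

/-- item stmt-AtomisticToContinuum-5295 · crux · rank 2 · closed · moot by None · by planner
why it might fail: Needs propagation of chaos for the collective fields |q_x|²/n along the DETERMINISTIC flow with Gibbs data up to kinetic times t≍n; the particle analogue (Lenard–Balescu on t≍N) is open — DuerinckxSaintraymond2021 reach t≍N^r, r<1/18, arXiv:2511.10778 only a truncated hierarchy.
sources: DuerinckxSaintraymond2021, arXiv:2511.10778, Duerinckx2021, LukkarinenSpohn2010, AokiLukkarinenSpohn2006 §3, Spohn2006PhononBoltzmann
[crux] (card L2, existence half) KINETIC WINDOW: for all ω₂, lam, β > 0, T > 0 there is a finite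
positive Borel measure ν_T on [0, ∞) (the spectral measure of the NLO kinetic generator at the
current) such that for every τ > 0: eventually in n, eventually in M, for every flow Φ,
|𝒦_{n,M}(nτ)/n − τ⁻¹ ∫_0^τ (τ − u) (∫ e^{−us} dν_T(s)) du| ≤ ε — i.e. at times t = nτ the
per-component current autocorrelation converges, after the Fejér average built into 𝒦, to the
Laplace transform c_T(u) = ∫ e^{−us} dν_T(s) = ⟨v, e^{−uL}v⟩ of a positive operator; the oscillatory
Hartree terms average out under the u-integral and need no pointwise limit. [difficulty:
open-problem] -/
@[route_item "route-AtomisticToContinuum-PhononLenardBalescu"]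
def KineticWindowLaplace : Prop :=
  ∀ (ω₂ lam β : ℝ), 0 < ω₂ → 0 < lam → 0 < β → ∀ (T : ℝ), 0 < T → let H : (n M : ℕ) → (Fin M → Fin n → ℝ) × (Fin M → Fin n → ℝ) → ℝ := fun n M z => (∑ x : Fin M, ((∑ a, (z.2 x a) ^ 2) / 2 + ω₂ * (∑ a, (z.1 x a) ^ 2) / 2 + lam / (4 * (n : ℝ)) * (∑ a, (z.1 x a) ^ 2) ^ 2)) + ∑ x : Fin M, ∑ y : Fin M, (if y.val = x.val + 1 then ((∑ a, (z.1 y a - z.1 x a) ^ 2) / 2 + β / (4 * (n : ℝ)) * (∑ a, (z.1 y a - z.1 x a) ^ 2) ^ 2) else 0); let J : (n M : ℕ) → (Fin M → Fin n → ℝ) × (Fin M → Fin n → ℝ) → ℝ := fun n M z => ∑ x : Fin M, ∑ y : Fin M, (if y.val = x.val + 1 then -((1 + β / (n : ℝ) * ∑ a, (z.1 y a - z.1 x a) ^ 2) * (∑ a, (z.2 x a + z.2 y a) * (z.1 y a - z.1 x a))) / 2 else 0); let F : (n M : ℕ) → (Fin M → Fin n → ℝ) × (Fin M → Fin n → ℝ)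 → Fin M → Fin n → ℝ := fun n M z x a => -(ω₂ + lam / (n : ℝ) * ∑ b, (z.1 x b) ^ 2) * z.1 x a + (∑ y : Fin M, (if y.val = x.val + 1 then (1 + β / (n : ℝ) * ∑ b, (z.1 y b - z.1 x b) ^ 2) * (z.1 y a - z.1 x a) else 0)) - ∑ y : Fin M, (if x.val = y.val + 1 then (1 + β / (n : ℝ) * ∑ b, (z.1 x b - z.1 y b) ^ 2) * (z.1 x a - z.1 y a) else 0); let IsFlow : (n M : ℕ) → (ℝ → (Fin M → Fin n → ℝ) × (Fin M → Fin n → ℝ) → (Fin M → Fin n → ℝ) × (Fin M → Fin n → ℝ)) → Prop := fun n M Φ => Continuous (fun p : ℝ × ((Fin M → Fin n → ℝ) × (Fin M → Fin n → ℝ)) => Φ p.1 p.2) ∧ (∀ z, Φ 0 z = z) ∧ ∀ z (x : Fin M) (t : ℝ), HasDerivAt (fun s => (Φ s z).1 x) ((Φ t z).2 x) t ∧ HasDerivAt (fun s => (Φ s z).2 x) (F n M (Φ t z) x) t; let μ : (n M : ℕ) → MeasureTheory.Measure ((Fin M → Fin n → ℝ) × (Fin M → Fin n → ℝ)) := fun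 n M => (∫⁻ z, ENNReal.ofReal (Real.exp (-(H n M z) / T)))⁻¹ • MeasureTheory.volume.withDensity (fun z => ENNReal.ofReal (Real.exp (-(H n M z) / T))); let 𝒦 : (n M : ℕ) → (ℝ → (Fin M → Fin n → ℝ) × (Fin M → Fin n → ℝ) → (Fin M → Fin n → ℝ) × (Fin M → Fin n → ℝ)) → ℝ → ENNReal := fun n M Φ t => ENNReal.ofReal (1 / (2 * t * (M : ℝ) * (n : ℝ) * T ^ 2)) * ∫⁻ z, ENNReal.ofReal ((∫ s in (0 : ℝ)..t, J n M (Φ s z)) ^ 2) ∂(μ n M); ∃ ν : MeasureTheory.Measure ℝ, MeasureTheory.IsFiniteMeasure ν ∧ ν (Set.Iio 0) = 0 ∧ ∀ τ : ℝ, 0 < τ → ∀ ε : ℝ, 0 < ε → ∀ᶠ n : ℕ in Filter.atTop, ∀ᶠ M : ℕ in Filter.atTop, ∀ Φ, IsFlow n M Φ → |(𝒦 n M Φ ((n : ℝ) * τ)).toReal / (n : ℝ) - τ⁻¹ * (∫ u in (0 : ℝ)..τ, (τ - u) * (∫ s, Real.exp (-(u * s)) ∂ν))| ≤ ε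

/-- item stmt-AtomisticToContinuum-5296 · crux · rank 4 · closed · moot by None · by planner
why it might fail: Fails if ν has an atom at 0 (hidden odd conserved quantity, or an undamped breathing mode: a real zero of 1−lamΠ_T on the two-phonon continuum) or an anomalous tail ∫s⁻¹dν=∞ as for unpinned FPU (LukkarinenSpohn2008, t^(-3/5)); pinning of the Hartree band is essential.
sources: LukkarinenSpohn2008 Thm 2.2/Prop 2.4/Thm 2.5, Spohn2006, AokiLukkarinenSpohn2006 §3 (3.25), HuveneersLukkarinen2020, DuerinckxWinter2023
[crux] (card: LBKernelPositivity, abstract form) for all parameters and T > 0 and every finite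
measure ν on [0,∞) whose Fejér–Laplace transform is the kinetic-window limit of 𝒦_{n,M}(nτ)/n
(hypothesis = the conclusion of KineticWindowLaplace for this ν; ν is then unique): ν{0} = 0 (no
zero mode of the NLO operator in the odd/current sector: the collisional invariants number and
energy are even), ν ≠ 0, and ∫_{(0,∞)} s⁻¹ dν(s) < ∞ (the current lies in the domain of L^{−1/2}: no
anomalous tail) — so that κ̄(T) = ∫ s⁻¹ dν = ⟨v, L⁻¹v⟩ ∈ (0, ∞). [deps: KineticWindowLaplace]
[difficulty: L] -/
@[route_item "route-AtomisticToContinuum-PhononLenardBalescu"]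
def WindowSpectralPositivity : Prop :=
  ∀ (ω₂ lam β : ℝ), 0 < ω₂ → 0 < lam → 0 < β → ∀ (T : ℝ), 0 < T → let H : (n M : ℕ) → (Fin M → Fin n → ℝ) × (Fin M → Fin n → ℝ) → ℝ := fun n M z => (∑ x : Fin M, ((∑ a, (z.2 x a) ^ 2) / 2 + ω₂ * (∑ a, (z.1 x a) ^ 2) / 2 + lam / (4 * (n : ℝ)) * (∑ a, (z.1 x a) ^ 2) ^ 2)) + ∑ x : Fin M, ∑ y : Fin M, (if y.val = x.val + 1 then ((∑ a, (z.1 y a - z.1 x a) ^ 2) / 2 + β / (4 * (n : ℝ)) * (∑ a, (z.1 y a - z.1 x a) ^ 2) ^ 2) else 0); let J : (n M : ℕ) → (Fin M → Fin n → ℝ) × (Fin M → Fin n → ℝ) → ℝ := fun n M z => ∑ x : Fin M, ∑ y : Fin M, (if y.val = x.val + 1 then -((1 + β / (n : ℝ) * ∑ a, (z.1 y a - z.1 x a) ^ 2) * (∑ a, (z.2 x a + z.2 y a) * (z.1 y a - z.1 x a))) / 2 else 0); let F : (n M : ℕ) → (Fin M → Fin n → ℝ) × (Fin M → Fin n → ℝ)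 → Fin M → Fin n → ℝ := fun n M z x a => -(ω₂ + lam / (n : ℝ) * ∑ b, (z.1 x b) ^ 2) * z.1 x a + (∑ y : Fin M, (if y.val = x.val + 1 then (1 + β / (n : ℝ) * ∑ b, (z.1 y b - z.1 x b) ^ 2) * (z.1 y a - z.1 x a) else 0)) - ∑ y : Fin M, (if x.val = y.val + 1 then (1 + β / (n : ℝ) * ∑ b, (z.1 x b - z.1 y b) ^ 2) * (z.1 x a - z.1 y a) else 0); let IsFlow : (n M : ℕ) → (ℝ → (Fin M → Fin n → ℝ) × (Fin M → Fin n → ℝ) → (Fin M → Fin n → ℝ) × (Fin M → Fin n → ℝ)) → Prop := fun n M Φ => Continuous (fun p : ℝ × ((Fin M → Fin n → ℝ) × (Fin M → Fin n → ℝ)) => Φ p.1 p.2) ∧ (∀ z, Φ 0 z = z) ∧ ∀ z (x : Fin M) (t : ℝ), HasDerivAt (fun s => (Φ s z).1 x) ((Φ t z).2 x) t ∧ HasDerivAt (fun s => (Φ s z).2 x) (F n M (Φ t z) x) t; let μ : (n M : ℕ) → MeasureTheory.Measure ((Fin M → Fin n → ℝ) × (Fin M → Fin n → ℝ)) := fun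 n M => (∫⁻ z, ENNReal.ofReal (Real.exp (-(H n M z) / T)))⁻¹ • MeasureTheory.volume.withDensity (fun z => ENNReal.ofReal (Real.exp (-(H n M z) / T))); let 𝒦 : (n M : ℕ) → (ℝ → (Fin M → Fin n → ℝ) × (Fin M → Fin n → ℝ) → (Fin M → Fin n → ℝ) × (Fin M → Fin n → ℝ)) → ℝ → ENNReal := fun n M Φ t => ENNReal.ofReal (1 / (2 * t * (M : ℝ) * (n : ℝ) * T ^ 2)) * ∫⁻ z, ENNReal.ofReal ((∫ s in (0 : ℝ)..t, J n M (Φ s z)) ^ 2) ∂(μ n M); ∀ ν : MeasureTheory.Measure ℝ, MeasureTheory.IsFiniteMeasure ν → ν (Set.Iio 0) = 0 → (∀ τ : ℝ, 0 < τ → ∀ ε : ℝ, 0 < ε → ∀ᶠ n : ℕ in Filter.atTop, ∀ᶠ M : ℕ in Filter.atTop, ∀ Φ, IsFlow n M Φ → |(𝒦 n M Φ ((n : ℝ) * τ)).toReal / (n : ℝ) - τ⁻¹ * (∫ u in (0 : ℝ)..τ, (τ - u) * (∫ s, Real.exp (-(u * s)) ∂ν))| ≤ ε) → ν {0} = 0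 ∧ ν ≠ 0 ∧ ∫⁻ s in Set.Ioi 0, ENNReal.ofReal s⁻¹ ∂ν < ⊤

/-- item stmt-AtomisticToContinuum-5297 · crux · rank 5 · closed · moot by None · by planner
why it might fail: The golden-rule regime n^(1/2)≪t≪n must carry no secular 1/n term other than −σt: a degenerate resonance (van Hove edge of the Hartree band on the 2↔2 manifold) or slowly ringing collective modes could make the 1/n correction superlinear in t; for r≤1/2 the signal is masked by O(1/t) tails.
sources: DuerinckxSaintraymond2021, Duerinckx2021, MihailaDawsonCooper2001, AartsBerges2002, BergesRothkopfSchmidt2008, LukkarinenSpohn2010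
[crux] (accessible rung, golden-rule regime) there is σ_T > 0 (the screened golden-rule rate ⟨v, Lv⟩
in the units of 𝒦) such that for every r ∈ (1/2, 1) and s₁, s₂ > 0: eventually in n, eventually in
M, for every flow, n^{1−r} [𝒦_{n,M}(n^r s₁)/(n^r s₁) − 𝒦_{n,M}(n^r s₂)/(n^r s₂)] → σ_T (s₂ − s₁)/6 —
i.e. for n^{1/2} ≪ t ≪ n one has 𝒦_{n,M}(t)/t = D_{T,n}/2 − σ_T t/(6n) + O(1/t): resistance appears
at FIRST order in 1/n with a positive rate; the two-time difference cancels the finite-n plateau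
D_{T,n} and the O(1/t) band-edge tails of the Hartree chain (hence r > 1/2). [difficulty: L] -/
@[route_item "route-AtomisticToContinuum-PhononLenardBalescu"]
def OnsetOfDamping : Prop :=
  ∀ (ω₂ lam β : ℝ), 0 < ω₂ → 0 < lam → 0 < β → ∀ (T : ℝ), 0 < T → let H : (n M : ℕ) → (Fin M → Fin n → ℝ) × (Fin M → Fin n → ℝ) → ℝ := fun n M z => (∑ x : Fin M, ((∑ a, (z.2 x a) ^ 2) / 2 + ω₂ * (∑ a, (z.1 x a) ^ 2) / 2 + lam / (4 * (n : ℝ)) * (∑ a, (z.1 x a) ^ 2) ^ 2)) + ∑ x : Fin M, ∑ y : Fin M, (if y.val = x.val + 1 then ((∑ a, (z.1 y a - z.1 x a) ^ 2) / 2 + β / (4 * (n : ℝ)) * (∑ a, (z.1 y a - z.1 x a) ^ 2) ^ 2) else 0); let J : (n M : ℕ) → (Fin M → Fin n → ℝ) × (Fin M → Fin n → ℝ) → ℝ := fun n M z => ∑ x : Fin M, ∑ y : Fin M, (if y.val = x.val + 1 then -((1 + β / (n : ℝ) * ∑ a, (z.1 y a - z.1 x a) ^ 2) * (∑ a, (z.2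 x a + z.2 y a) * (z.1 y a - z.1 x a))) / 2 else 0); let F : (n M : ℕ) → (Fin M → Fin n → ℝ) × (Fin M → Fin n → ℝ) → Fin M → Fin n → ℝ := fun n M z x a => -(ω₂ + lam / (n : ℝ) * ∑ b, (z.1 x b) ^ 2) * z.1 x a + (∑ y : Fin M, (if y.val = x.val + 1 then (1 + β / (n : ℝ) * ∑ b, (z.1 y b - z.1 x b) ^ 2) * (z.1 y a - z.1 x a) else 0)) - ∑ y : Fin M, (if x.val = y.val + 1 then (1 + β / (n : ℝ) * ∑ b, (z.1 x b - z.1 y b) ^ 2) * (z.1 x a - z.1 y a) else 0); let IsFlow : (n M : ℕ) → (ℝ → (Fin M → Fin n → ℝ) × (Fin M → Fin n → ℝ) → (Fin M → Fin n → ℝ) × (Fin M → Fin n → ℝ)) → Prop := fun n M Φ => Continuous (fun p : ℝ × ((Fin M → Fin n → ℝ) × (Fin M → Fin n → ℝ)) => Φ p.1 p.2) ∧ (∀ z, Φ 0 z = z) ∧ ∀ z (x : Fin M) (t : ℝ), HasDerivAt (fun s => (Φ s z).1 x) ((Φ t z).2 x) t ∧ HasDerivAt (fun s => (Φ s z).2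 x) (F n M (Φ t z) x) t; let μ : (n M : ℕ) → MeasureTheory.Measure ((Fin M → Fin n → ℝ) × (Fin M → Fin n → ℝ)) := fun n M => (∫⁻ z, ENNReal.ofReal (Real.exp (-(H n M z) / T)))⁻¹ • MeasureTheory.volume.withDensity (fun z => ENNReal.ofReal (Real.exp (-(H n M z) / T))); let 𝒦 : (n M : ℕ) → (ℝ → (Fin M → Fin n → ℝ) × (Fin M → Fin n → ℝ) → (Fin M → Fin n → ℝ) × (Fin M → Fin n → ℝ)) → ℝ → ENNReal := fun n M Φ t => ENNReal.ofReal (1 / (2 * t * (M : ℝ) * (n : ℝ) * T ^ 2)) * ∫⁻ z, ENNReal.ofReal ((∫ s in (0 : ℝ)..t, J n M (Φ s z)) ^ 2) ∂(μ n M); ∃ σ : ℝ, 0 < σ ∧ ∀ r : ℝ, 1 / 2 < r → r < 1 → ∀ s₁ s₂ : ℝ, 0 < s₁ → 0 < s₂ → ∀ ε : ℝ, 0 < ε → ∀ᶠ n : ℕ in Filter.atTop, ∀ᶠ M : ℕ in Filter.atTop, ∀ Φ, IsFlow n M Φ → |(n : ℝ) ^ (1 - r) * ((𝒦 n M Φ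 ((n : ℝ) ^ r * s₁)).toReal / ((n : ℝ) ^ r * s₁) - (𝒦 n M Φ ((n : ℝ) ^ r * s₂)).toReal / ((n : ℝ) ^ r * s₂)) - σ * (s₂ - s₁) / 6| ≤ ε

-- item stmt-AtomisticToContinuum-6400 · support · rank 3 · closed · moot by None · by planner — informal only, no Lean statement yet:
--   [crux] LENARD–BALESCU IDENTIFICATION (card L2, identification half; rank 3; needs definition
--   PhononLenardBalescuOperator before a signature can be set). For the O(n) chain of this route (inline
--   objects H_n, J, flow, Gibbs(T), Einstein–Helfand conductivity 𝒦_{n,M}) and every ω₂, lam, β > 0, T >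
--   0: (i) the leading-order constant D_T of HartreeBallisticLeadingOrder is the per-site,
--   T⁻²-normalised energy-current Drude weight of the HARMONIC chain with pinning Ω_T and bond stiffness
--   K_T, (Ω_T, K_T) the positive solution of HartreeGapEquation (Hartree band ω̃_T(k)² = Ω_T + 2K_T(1 −
--   cos k), current s

/-- item stmt-AtomisticToContinuum-5298 · support · rank 9 · closed · moot by None · by planner
sources: Sznitman1991, doi:10.1007/BF01611497 (Braun–Hepp 1977), BricmontKupiainen2007 §3 (naive closure = renormalised ω₂, ballistic), RoyDhar2008, decl Literature.Barriers.AtomisticToContinuum.HarmonicChainBallisticFlux (proved)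
[support] (card L0: the harmonic barrier as derived leading order) there is D_T > 0 (the Drude
weight of the Hartree harmonic chain with stiffnesses (Ω_T, K_T)) such that ∀ ε ∃ t₀ ∀ t ≥ t₀:
eventually in n, eventually in M, for every flow, |𝒦_{n,M}(t)/t − D_T/2| ≤ ε — at FIXED time the n →
∞ limit is the Hartree harmonic chain (law of large numbers over components / McKean–Vlasov limit
with Gibbs data) and it conducts ballistically (𝒦 grows linearly), i.e. HarmonicChainBallisticFlux
as a limit theorem; provable with known technology (propagation of chaos on bounded times + Gaussian
computation). [difficulty: M] -/
@[route_item "route-AtomisticToContinuum-PhononLenardBalescu"]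
def HartreeBallisticLeadingOrder : Prop :=
  ∀ (ω₂ lam β : ℝ), 0 < ω₂ → 0 < lam → 0 < β → ∀ (T : ℝ), 0 < T → let H : (n M : ℕ) → (Fin M → Fin n → ℝ) × (Fin M → Fin n → ℝ) → ℝ := fun n M z => (∑ x : Fin M, ((∑ a, (z.2 x a) ^ 2) / 2 + ω₂ * (∑ a, (z.1 x a) ^ 2) / 2 + lam / (4 * (n : ℝ)) * (∑ a, (z.1 x a) ^ 2) ^ 2)) + ∑ x : Fin M, ∑ y : Fin M, (if y.val = x.val + 1 then ((∑ a, (z.1 y a - z.1 x a) ^ 2) / 2 + β / (4 * (n : ℝ)) * (∑ a, (z.1 y a - z.1 x a) ^ 2) ^ 2) else 0); let J : (n M : ℕ) → (Fin M → Fin n → ℝ) × (Fin M → Fin n → ℝ) → ℝ := fun n M z => ∑ x : Fin M, ∑ y : Fin M, (if y.val = x.val + 1 then -((1 + β / (n : ℝ) * ∑ a, (z.1 y a - z.1 x a) ^ 2) * (∑ a, (z.2 x a + z.2 y a) * (z.1 y a - z.1 x a))) / 2 else 0); let F : (n M : ℕ) → (Fin M → Fin n → ℝ) × (Fin M → Fin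 n → ℝ) → Fin M → Fin n → ℝ := fun n M z x a => -(ω₂ + lam / (n : ℝ) * ∑ b, (z.1 x b) ^ 2) * z.1 x a + (∑ y : Fin M, (if y.val = x.val + 1 then (1 + β / (n : ℝ) * ∑ b, (z.1 y b - z.1 x b) ^ 2) * (z.1 y a - z.1 x a) else 0)) - ∑ y : Fin M, (if x.val = y.val + 1 then (1 + β / (n : ℝ) * ∑ b, (z.1 x b - z.1 y b) ^ 2) * (z.1 x a - z.1 y a) else 0); let IsFlow : (n M : ℕ) → (ℝ → (Fin M → Fin n → ℝ) × (Fin M → Fin n → ℝ) → (Fin M → Fin n → ℝ) × (Fin M → Fin n → ℝ)) → Prop := fun n M Φ => Continuous (fun p : ℝ × ((Fin M → Fin n → ℝ) × (Fin M → Fin n → ℝ)) => Φ p.1 p.2) ∧ (∀ z, Φ 0 z = z) ∧ ∀ z (x : Fin M) (t : ℝ), HasDerivAt (fun s => (Φ s z).1 x) ((Φ t z).2 x) t ∧ HasDerivAt (fun s => (Φ s z).2 x) (F n M (Φ t z) x) t; let μ : (n M : ℕ) → MeasureTheory.Measure ((Fin M → Fin n → ℝ) × (Fin M → Fin n → ℝ))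 := fun n M => (∫⁻ z, ENNReal.ofReal (Real.exp (-(H n M z) / T)))⁻¹ • MeasureTheory.volume.withDensity (fun z => ENNReal.ofReal (Real.exp (-(H n M z) / T))); let 𝒦 : (n M : ℕ) → (ℝ → (Fin M → Fin n → ℝ) × (Fin M → Fin n → ℝ) → (Fin M → Fin n → ℝ) × (Fin M → Fin n → ℝ)) → ℝ → ENNReal := fun n M Φ t => ENNReal.ofReal (1 / (2 * t * (M : ℝ) * (n : ℝ) * T ^ 2)) * ∫⁻ z, ENNReal.ofReal ((∫ s in (0 : ℝ)..t, J n M (Φ s z)) ^ 2) ∂(μ n M); ∃ D : ℝ, 0 < D ∧ ∀ ε : ℝ, 0 < ε → ∃ t₀ : ℝ, ∀ t : ℝ, t₀ ≤ t → 0 < t → ∀ᶠ n : ℕ in Filter.atTop, ∀ᶠ M : ℕ in Filter.atTop, ∀ Φ, IsFlow n M Φ → |(𝒦 n M Φ t).toReal / t - D / 2| ≤ ε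

/-- item stmt-AtomisticToContinuum-5299 · support · rank 9 · closed · moot by None · by planner
sources: ColemanJackiwPolitzer1974, decl Literature.Barriers.AtomisticToContinuum.LowTemperatureWeakAnharmonicity (scaling conjugacy), AokiLukkarinenSpohn2006 §2 (2.11)-(2.12)
[support] (card L1, T-uniformity) for ω₂ > 0, lam, β ≥ 0 and every T > 0 the Hartree gap equations Ω
= ω₂ + lam T/√(Ω(Ω+4K)), K = 1 + (βT/K)(1 − √(Ω/(Ω+4K))) (equilibrium variances of the harmonic
chain with pinning Ω and bond stiffness K: E q² = T/√(Ω(Ω+4K)), E r² = (T/K)(1 − √(Ω/(Ω+4K)))) have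
a positive solution, and for lam, β > 0 EVERY positive solution satisfies c√T ≤ Ω, K ≤ C√T for T ≥
T₀ (scale-free regime: the Hartree frequency grows exactly like the thermal amplitude, so the
relative NLO strength g(T)/n stays bounded along the whole temperature ray). Real analysis, provable
now; planner numerics: unique solution found, Ω/√T → 0.647, K/√T → 0.763 at ω₂ = lam = β = 1.
[difficulty: provable-now] -/
@[route_item "route-AtomisticToContinuum-PhononLenardBalescu"]
def HartreeGapEquation : Prop :=
  ∀ (ω₂ lam β : ℝ), 0 < ω₂ → 0 ≤ lam → 0 ≤ β → (∀ T : ℝ, 0 < T → ∃ Ω K : ℝ, 0 < Ω ∧ 0 < K ∧ Ω = ω₂ + lam * T / Real.sqrt (Ω * (Ω + 4 * K)) ∧ K = 1 + β * T / K * (1 - Real.sqrt (Ω / (Ω + 4 * K)))) ∧ (0 < lam → 0 < β → ∃ c C T₀ : ℝ, 0 < c ∧ 0 < T₀ ∧ ∀ T : ℝ, T₀ ≤ T → ∀ Ω K : ℝ, 0 < Ω → 0 < K → Ω = ω₂ + lam * T / Real.sqrt (Ω * (Ω + 4 * K)) → K = 1 + β * T / K * (1 - Real.sqrt (Ω / (Ω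 + 4 * K))) → c * Real.sqrt T ≤ Ω ∧ Ω ≤ C * Real.sqrt T ∧ c * Real.sqrt T ≤ K ∧ K ≤ C * Real.sqrt T)

/-- item stmt-AtomisticToContinuum-5300 · support · rank 9 · closed · moot by None · by planner
sources: Mazur1969, decl Literature.Barriers.AtomisticToContinuum.Mazur1969_inequality, Spohn2006
[support] (card L3) for n ≥ 2 and a ≠ b the angular momenta L^{ab} = Σ_x (q^a_x p^b_x − q^b_x p^a_x)
are conserved by every flow of the O(n) chain, J·L^{ab} is Gibbs-integrable and E_{Gibbs}[J L^{ab}]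
= 0 (reflection q^a, p^a ↦ −q^a, −p^a preserves H, J and the Gibbs measure and flips L^{ab}): the
extra extensive charges of the vector chain are Mazur-silent for the heat current. Provable now
(polynomial × Gaussian-dominated integrability; measure-preserving involution). [difficulty:
provable-now] -/
@[route_item "route-AtomisticToContinuum-PhononLenardBalescu"]
def NoetherMazurSilence : Prop :=
  ∀ (ω₂ lam β : ℝ), 0 < ω₂ → 0 < lam → 0 < β → ∀ (T : ℝ), 0 < T → let H : (n M : ℕ) → (Fin M → Fin n → ℝ) × (Fin M → Fin n → ℝ) → ℝ := fun n M z => (∑ x : Fin M, ((∑ a, (z.2 x a) ^ 2) / 2 + ω₂ * (∑ a, (z.1 x a) ^ 2) / 2 + lam / (4 * (n : ℝ)) * (∑ a, (z.1 x a) ^ 2) ^ 2)) + ∑ x : Fin M, ∑ y : Fin M, (if y.val = x.val + 1 then ((∑ a, (z.1 y a - z.1 x a) ^ 2) / 2 + β / (4 * (n : ℝ)) * (∑ a, (z.1 y a - z.1 x a) ^ 2) ^ 2) else 0); let J : (n M : ℕ) → (Fin M → Fin n → ℝ) × (Fin M → Fin n → ℝ) → ℝ := fun n M z => ∑ x : Fin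 M, ∑ y : Fin M, (if y.val = x.val + 1 then -((1 + β / (n : ℝ) * ∑ a, (z.1 y a - z.1 x a) ^ 2) * (∑ a, (z.2 x a + z.2 y a) * (z.1 y a - z.1 x a))) / 2 else 0); let F : (n M : ℕ) → (Fin M → Fin n → ℝ) × (Fin M → Fin n → ℝ) → Fin M → Fin n → ℝ := fun n M z x a => -(ω₂ + lam / (n : ℝ) * ∑ b, (z.1 x b) ^ 2) * z.1 x a + (∑ y : Fin M, (if y.val = x.val + 1 then (1 + β / (n : ℝ) * ∑ b, (z.1 y b - z.1 x b) ^ 2) * (z.1 y a - z.1 x a) else 0)) - ∑ y : Fin M, (if x.val = y.val + 1 then (1 + β / (n : ℝ) * ∑ b, (z.1 x b - z.1 y b) ^ 2) * (z.1 x a - z.1 y a) else 0); let IsFlow : (n M : ℕ) → (ℝ → (Fin M → Fin n → ℝ) × (Fin M → Fin n → ℝ) → (Fin M → Fin n → ℝ) × (Fin M → Fin n → ℝ)) → Prop := fun n M Φ => Continuous (fun p : ℝ × ((Fin M → Fin n → ℝ) × (Fin M → Fin n → ℝ)) => Φ p.1 p.2) ∧ (∀ z, Φ 0 z = z) ∧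 ∀ z (x : Fin M) (t : ℝ), HasDerivAt (fun s => (Φ s z).1 x) ((Φ t z).2 x) t ∧ HasDerivAt (fun s => (Φ s z).2 x) (F n M (Φ t z) x) t; let μ : (n M : ℕ) → MeasureTheory.Measure ((Fin M → Fin n → ℝ) × (Fin M → Fin n → ℝ)) := fun n M => (∫⁻ z, ENNReal.ofReal (Real.exp (-(H n M z) / T)))⁻¹ • MeasureTheory.volume.withDensity (fun z => ENNReal.ofReal (Real.exp (-(H n M z) / T))); ∀ (n M : ℕ) (a b : Fin n), a ≠ b → (∀ Φ, IsFlow n M Φ → ∀ z (t : ℝ), (∑ x : Fin M, ((Φ t z).1 x a * (Φ t z).2 x b - (Φ t z).1 x b * (Φ t z).2 x a)) = ∑ x : Fin M, (z.1 x a * z.2 x b - z.1 x b * z.2 x a)) ∧ MeasureTheory.Integrable (fun z => J n M z * ∑ x : Fin M, (z.1 x a * z.2 x b - z.1 x b * z.2 x a)) (μ n M) ∧ (∫ z, (J n M z * ∑ x : Fin M, (z.1 x a * z.2 x b - z.1 x b * z.2 x a)) ∂(μ n M)) = 0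

/-- item stmt-AtomisticToContinuum-5301 · support · rank 9 · closed · moot by None · by planner
sources: BonettoLebowitzReyBellet2000 §3 eq. (8) and §5.2 eq. (23), decl Literature.MathematicalPhysics.KineticTheory.HeatConduction.pinnedChain
[support] (the family contains the conjunct's chain) at n = 1 the inline Hamiltonian and total
current coincide with the tree's: H_{1,M}(z) = (pinnedChain ω₂ lam β γ).hamiltonian M (q, p) and
J_{1,M}(z) = Σ_i (pinnedChain ω₂ lam β γ).bondCurrent M i (q, p) with q_i = z.1 i 0, p_i = z.2 i 0
(deriv of V(r) = r²/2 + βr⁴/4 is (1 + βr²)r). Definitional regression test, provable now by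
simp/ring. [difficulty: provable-now] -/
@[route_item "route-AtomisticToContinuum-PhononLenardBalescu"]
def AtOneIsPinnedChain : Prop :=
  ∀ (ω₂ lam β γ : ℝ), let H : (n M : ℕ) → (Fin M → Fin n → ℝ) × (Fin M → Fin n → ℝ) → ℝ := fun n M z => (∑ x : Fin M, ((∑ a, (z.2 x a) ^ 2) / 2 + ω₂ * (∑ a, (z.1 x a) ^ 2) / 2 + lam / (4 * (n : ℝ)) * (∑ a, (z.1 x a) ^ 2) ^ 2)) + ∑ x : Fin M, ∑ y : Fin M, (if y.val = x.val + 1 then ((∑ a, (z.1 y a - z.1 x a) ^ 2) / 2 + β / (4 * (n : ℝ)) * (∑ a, (z.1 y a - z.1 x a) ^ 2) ^ 2) else 0); let J : (n M : ℕ) → (Fin M → Fin n → ℝ) × (Fin M → Fin n → ℝ) → ℝ := fun n M z => ∑ x : Fin M, ∑ y : Fin M, (if y.val = x.val + 1 then -((1 + β / (n : ℝ) * ∑ a, (z.1 y a - z.1 x a) ^ 2) * (∑ a, (z.2 x a + z.2 y a) * (z.1 y a - z.1 x a))) / 2 else 0); ∀ (M : ℕ) (z : (Fin M → Fin 1 →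 ℝ) × (Fin M → Fin 1 → ℝ)), H 1 M z = (Literature.MathematicalPhysics.KineticTheory.HeatConduction.pinnedChain ω₂ lam β γ).hamiltonian M (fun i => z.1 i 0, fun i => z.2 i 0) ∧ J 1 M z = ∑ i : Fin M, (Literature.MathematicalPhysics.KineticTheory.HeatConduction.pinnedChain ω₂ lam β γ).bondCurrent M i (fun i => z.1 i 0, fun i => z.2 i 0)

/-- item stmt-AtomisticToContinuum-5302 · support · rank 9 · closed · moot by None · by planner
sources: LanfordLebowitzLieb1977 (contrast: infinite volume), folklore (Picard–Lindelöf + energy conservation), Mathlib IsPicardLindelof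
[support] (non-vacuity of `∀ Φ, IsFlow n M Φ → …`) for ω₂, lam, β > 0 and all n, M the Hamiltonian
vector field of the O(n) chain (explicit polynomial force F = −∇_q H_n) has a unique global flow in
the class IsFlow (jointly continuous, Φ_0 = id, Hamilton's equations everywhere): local
Picard–Lindelöf + conservation of the coercive energy H_n ≥ Σ|p|²/2 + ω₂Σ|q|²/2. [difficulty: M] -/
@[route_item "route-AtomisticToContinuum-PhononLenardBalescu"]
def GlobalFlow : Prop :=
  ∀ (ω₂ lam β : ℝ), 0 < ω₂ → 0 < lam → 0 < β → let F : (n M : ℕ) → (Fin M → Fin n → ℝ) × (Fin M → Fin n → ℝ) → Fin M → Fin n → ℝ := fun n M z x a => -(ω₂ + lam / (n : ℝ) * ∑ b, (z.1 x b) ^ 2) * z.1 x a + (∑ y : Fin M, (if y.val = x.val + 1 then (1 + β / (n : ℝ) * ∑ b, (z.1 y b - z.1 x b) ^ 2) * (z.1 y a - z.1 x a) else 0)) - ∑ y : Fin M, (if x.val = y.val + 1 then (1 + β / (n : ℝ) * ∑ b, (z.1 x b - z.1 y b) ^ 2) * (z.1 x a - z.1 y a) else 0); let IsFlow : (n M :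 ℕ) → (ℝ → (Fin M → Fin n → ℝ) × (Fin M → Fin n → ℝ) → (Fin M → Fin n → ℝ) × (Fin M → Fin n → ℝ)) → Prop := fun n M Φ => Continuous (fun p : ℝ × ((Fin M → Fin n → ℝ) × (Fin M → Fin n → ℝ)) => Φ p.1 p.2) ∧ (∀ z, Φ 0 z = z) ∧ ∀ z (x : Fin M) (t : ℝ), HasDerivAt (fun s => (Φ s z).1 x) ((Φ t z).2 x) t ∧ HasDerivAt (fun s => (Φ s z).2 x) (F n M (Φ t z) x) t; ∀ (n M : ℕ), ∃ Φ, IsFlow n M Φ ∧ ∀ Ψ, IsFlow n M Ψ → Ψ = Φ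

/-- item stmt-AtomisticToContinuum-5303 · assembly · rank 1 · closed · moot by None · by planner
sources: DuerinckxSaintraymond2021, Spohn2006PhononBoltzmann, folklore (Bernstein–Widder / Tonelli)
[assembly] KineticWindowLaplace → WindowSpectralPositivity → KineticWindowConductivity
(Laplace–Fejér calculus + dominated convergence; ~200 Lean lines). -/
@[route_item "route-AtomisticToContinuum-PhononLenardBalescu"]
def Assembly : Prop :=
  KineticWindowLaplace → WindowSpectralPositivity → KineticWindowConductivity

end Summit.AtomisticToContinuum.FouriersLaw.Theses.PhononLenardBalescu
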